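import Literature.Probability.RandomPlanarGeometry.RohdeSchrammGhatODE
import HarnessLib

/-!
# The hypergeometric equation for `₂F₁(α, β, 1/2, ·)` and Rohde–Schramm's (6.9) for general exponent `a`

Trunk T-STOCH; layer 5c′ (real analysis) of the decomposition of the space-filling phase of SLE_κ
(`Literature.Probability.RandomPlanarGeometry.ae_isSpaceFilling_sleTrace_of_eight_le`;
Rohde–Schramm, Ann. Math. 161 (2005), Cor. 7.4 + Update). The Itô step of Lemma 6.3
(`Literature.Probability.RandomPlanarGeometry.sle_martingale_rsObservable`, layer 4c) is stated
for **every** exponent `a < 0` with non-negative discriminant `32aκ + (2κ-8)²`, i.e. for the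
printed `Ĝ_{a,κ}(x + iy) = ₂F₁(η₀, η₁, 1/2, x²/(x²+y²))`, `η₀ ≠ η₁` in general
(`RohdeSchrammGhatODE.lean` treated the diagonal exponent `a(κ)`, `η₀ = η₁`). Here:

* for arbitrary real `α, β` the power series `F(r) = Σ cₙ rⁿ`,
  `cₙ = (α)ₙ (β)ₙ / ((1/2)ₙ n!)` (`hypHalfGenCoeff`), converges on `|r| < 1` (radius `≥ 1`:
  Mathlib `ordinaryHypergeometricSeries_radius_eq_one`, or `⊤` when `α` or `β` is a non-positive
  integer), is differentiated term-wise twice (`hasDerivAt_hypHalfGen`, `hasDerivAt_hypHalfGenDeriv`;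
  the derivative weights `n ρⁿ⁻¹ ≤ ρ'ⁿ/(ρ'(1 - ρ/ρ'))` are absorbed into a larger radius), and
  satisfies the **hypergeometric equation** `r(1-r) F'' + (1/2 - (α+β+1) r) F' - αβ F = 0`
  (`hypHalfGen_ode`; telescoping on `c_{n+1} = cₙ (α+n)(β+n)/((1/2+n)(n+1))`);
* for `κ > 0` and `32aκ + (2κ-8)² ≥ 0`, Rohde–Schramm's parameters satisfy
  `η₀ + η₁ = 1 - 4/κ`, `η₀ η₁ = -2a/κ` (`rsEta₀_add_rsEta₁`, `rsEta₀_mul_rsEta₁`), and the slope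
  function `h(w) = Ĝ_{a,κ}(w + i) = rsGhatSlope a κ w` satisfies **(6.9) at `y = 1`**:
  `(κ/2) h'' + (4w/(1+w²)) h' + (4a/(1+w²)²) h = 0` (`rsGhatSlope_ode`, `rsGhatSlope_ode'`), is
  smooth (`contDiff_rsGhatSlope`), and `rsGhat a κ z = h(Re z / Im z)` (`rsGhat_eq_rsGhatSlope`).

## References

* S. Rohde, O. Schramm, *Basic properties of SLE*, Ann. of Math. 161 (2005) 883–924: eq. (6.1),
  the definition of `Ĝ_{a,κ}`, `η₀, η₁` (p. 903), eq. (6.9) and the footnote on p. 904.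
-/

noncomputable section

open Set Filter Topology Metric Finset
open scoped NNReal ENNReal

namespace Literature.Probability.RandomPlanarGeometry

/-! ### An elementary weight bound -/

/-- `n qⁿ⁻¹ ≤ 1/(1-q)` for `0 ≤ q < 1` (`n qⁿ⁻¹ ≤ Σ_{k<n} qᵏ ≤ Σ qᵏ`). [folklore] -/
theorem nat_mul_pow_pred_le {q : ℝ} (hq0 : 0 ≤ q) (hq1 : q < 1) (n : ℕ) :
    (n : ℝ) * q ^ (n - 1) ≤ (1 - q)⁻¹ := by
  have h1 : (n : ℝ) * q ^ (n - 1) ≤ ∑ k ∈ range n, q ^ k := by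
    have h : ∑ _k ∈ range n, q ^ (n - 1) ≤ ∑ k ∈ range n, q ^ k :=
      sum_le_sum fun k hk ↦ pow_le_pow_of_le_one hq0 hq1.le (by
        have := mem_range.1 hk; omega)
    rwa [sum_const, card_range, nsmul_eq_mul] at h
  exact h1.trans (sum_le_hasSum (range n) (fun k _ ↦ pow_nonneg hq0 k)
    (hasSum_geometric_of_lt_one hq0 hq1))

/-! ### The power series of `₂F₁(α, β, 1/2, ·)` -/

section HypHalfGen

variable (α β : ℝ)

/-- The coefficients `cₙ = (α)ₙ (β)ₙ / ((1/2)ₙ n!)` of `₂F₁(α, β, 1/2, ·)` (Mathlib's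
`ordinaryHypergeometricCoefficient`; eq. (6.1) of Rohde–Schramm (2005)). [cite: RohdeSchramm2005, Lemma 6.3] -/
def hypHalfGenCoeff (n : ℕ) : ℝ :=
  ordinaryHypergeometricCoefficient α β (1 / 2 : ℝ) n

/-- `c₀ = 1`. [folklore] -/
theorem hypHalfGenCoeff_zero : hypHalfGenCoeff α β 0 = 1 := by
  simp [hypHalfGenCoeff, ordinaryHypergeometricCoefficient]

/-- **The coefficient recursion** `c_{n+1} = cₙ (α+n)(β+n)/((1/2+n)(n+1))`. [folklore] -/
theorem hypHalfGenCoeff_succ (n : ℕ) :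
    hypHalfGenCoeff α β (n + 1) =
      hypHalfGenCoeff α β n * ((α + n) * (β + n) / ((1 / 2 + n) * (n + 1))) := by
  have hP : (ascPochhammer ℝ n).eval (1 / 2 : ℝ) ≠ 0 :=
    (ascPochhammer_pos n (1 / 2 : ℝ) (by norm_num)).ne'
  have h1 : (1 / 2 + (n : ℝ)) ≠ 0 := by positivity
  have h2 : ((n : ℝ) + 1) ≠ 0 := by positivity
  have h3 : ((n.factorial : ℕ) : ℝ) ≠ 0 := by positivity
  unfold hypHalfGenCoeff ordinaryHypergeometricCoefficient
  rw [ascPochhammer_succ_eval, ascPochhammer_succ_eval, ascPochhammer_succ_eval,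
    Nat.factorial_succ, Nat.cast_mul, Nat.cast_succ]
  field_simp

/-- `₂F₁(α, β, 1/2, r) = Σ cₙ rⁿ` for every real `r` (Mathlib junk conventions agree). [folklore] -/
theorem hypHalfGen_eq_tsum (r : ℝ) : ₂F₁ α β (1 / 2 : ℝ) r = ∑' n, hypHalfGenCoeff α β n * r ^ n := by
  rw [ordinaryHypergeometric_eq_tsum]
  simp only [smul_eq_mul, hypHalfGenCoeff, ordinaryHypergeometricCoefficient]

/-- The first term-wise derivative series `F₁(r) = Σ cₙ n rⁿ⁻¹`. [folklore] -/
def hypHalfGenDeriv (r : ℝ) : ℝ := ∑' n : ℕ, hypHalfGenCoeff α β n * ((n : ℝ) * r ^ (n - 1))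

/-- The second term-wise derivative series `F₂(r) = Σ cₙ n (n-1) rⁿ⁻²`. [folklore] -/
def hypHalfGenDeriv₂ (r : ℝ) : ℝ :=
  ∑' n : ℕ, hypHalfGenCoeff α β n * ((n : ℝ) * (((n - 1 : ℕ) : ℝ) * r ^ (n - 1 - 1)))

/-- **The radius of convergence is at least `1`**: it is `1` unless `α` or `β` is a non-positive
integer, when the series terminates (Mathlib). [folklore] -/
theorem one_le_radius_hypHalfGen :
    1 ≤ (ordinaryHypergeometricSeries ℝ α β (1 / 2 : ℝ)).radius := by
  by_cases h : ∀ kn : ℕ, (kn : ℝ) ≠ -α ∧ (kn : ℝ) ≠ -β ∧ (kn : ℝ) ≠ -(1 / 2 : ℝ)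
  · rw [ordinaryHypergeometricSeries_radius_eq_one ℝ α β (1 / 2 : ℝ) h]
  · push Not at h
    obtain ⟨kn, hkn⟩ := h
    by_cases hα : (kn : ℝ) = -α
    · have hα' : α = -(kn : ℝ) := by linarith
      rw [hα', ordinaryHypergeometric_radius_top_of_neg_nat₁]
      exact le_top
    · by_cases hβ : (kn : ℝ) = -β
      · have hβ' : β = -(kn : ℝ) := by linarith
        rw [hβ', ordinaryHypergeometric_radius_top_of_neg_nat₂]
        exact le_top
      · exfalso
        have h3 := hkn hα hβ
        have := Nat.cast_nonneg (α := ℝ) kn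
        linarith

/-- `Σ |cₙ| ρⁿ` converges for `0 ≤ ρ < 1`. [folklore] -/
theorem summable_abs_hypHalfGenCoeff_mul_pow {ρ : ℝ} (hρ0 : 0 ≤ ρ) (hρ : ρ < 1) :
    Summable fun n ↦ |hypHalfGenCoeff α β n| * ρ ^ n := by
  set p := ordinaryHypergeometricSeries ℝ α β (1 / 2 : ℝ) with hp
  have hr1 : ρ.toNNReal < 1 := Real.toNNReal_lt_one.2 hρ
  have hr : (ρ.toNNReal : ℝ≥0∞) < p.radius :=
    lt_of_lt_of_le (ENNReal.coe_lt_one_iff.2 hr1) (one_le_radius_hypHalfGen α β)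
  have h := p.summable_norm_mul_pow hr
  refine h.congr fun n ↦ ?_
  simp only [hp, ordinaryHypergeometricSeries, FormalMultilinearSeries.ofScalars_norm,
    Real.norm_eq_abs, Real.coe_toNNReal _ hρ0, hypHalfGenCoeff]

/-- `Σ |cₙ| n ρⁿ⁻¹` converges for `0 ≤ ρ < 1` (compare with `Σ |cₙ| ρ'ⁿ`, `ρ < ρ' < 1`, through
`n (ρ/ρ')ⁿ⁻¹ ≤ 1/(1 - ρ/ρ')`). [folklore] -/
theorem summable_abs_hypHalfGenCoeff_mul_weight {ρ : ℝ} (hρ0 : 0 ≤ ρ) (hρ : ρ < 1) :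
    Summable fun n : ℕ ↦ |hypHalfGenCoeff α β n| * ((n : ℝ) * ρ ^ (n - 1)) := by
  obtain ⟨ρ', hρρ', hρ'1⟩ := exists_between hρ
  have hρ'0 : 0 < ρ' := hρ0.trans_lt hρρ'
  set q : ℝ := ρ / ρ' with hq
  have hq0 : 0 ≤ q := div_nonneg hρ0 hρ'0.le
  have hq1 : q < 1 := (div_lt_one hρ'0).2 hρρ'
  set K : ℝ := (1 - q)⁻¹ / ρ' with hK
  have hK0 : 0 ≤ K := div_nonneg (inv_nonneg.2 (by linarith)) hρ'0.le
  refine Summable.of_nonneg_of_le (fun n ↦ by positivity) (fun n ↦ ?_)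
    ((summable_abs_hypHalfGenCoeff_mul_pow α β hρ'0.le hρ'1).mul_left K)
  -- `n ρⁿ⁻¹ ≤ K ρ'ⁿ`
  have hw : (n : ℝ) * ρ ^ (n - 1) ≤ K * ρ' ^ n := by
    rcases n with _ | m
    · simp; positivity
    · have h1 := nat_mul_pow_pred_le hq0 hq1 (m + 1)
      simp only [Nat.add_sub_cancel] at h1 ⊢
      have hρeq : ρ = q * ρ' := by rw [hq]; field_simp
      rw [hρeq, mul_pow, ← mul_assoc, hK, pow_succ]
      have hρ'm : 0 < ρ' ^ m := pow_pos hρ'0 m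
      calc ((m + 1 : ℕ) : ℝ) * q ^ m * ρ' ^ m ≤ (1 - q)⁻¹ * ρ' ^ m :=
            mul_le_mul_of_nonneg_right h1 hρ'm.le
        _ = (1 - q)⁻¹ / ρ' * (ρ' ^ m * ρ') := by field_simp
  calc |hypHalfGenCoeff α β n| * ((n : ℝ) * ρ ^ (n - 1))
      ≤ |hypHalfGenCoeff α β n| * (K * ρ' ^ n) := mul_le_mul_of_nonneg_left hw (abs_nonneg _)
    _ = K * (|hypHalfGenCoeff α β n| * ρ' ^ n) := by ring

/-- `Σ |cₙ| n (n-1) ρⁿ⁻²` converges for `0 ≤ ρ < 1` (compare with `Σ |cₙ| n ρ'ⁿ⁻¹`). [folklore] -/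
theorem summable_abs_hypHalfGenCoeff_mul_weight₂ {ρ : ℝ} (hρ0 : 0 ≤ ρ) (hρ : ρ < 1) :
    Summable fun n : ℕ ↦
      |hypHalfGenCoeff α β n| * ((n : ℝ) * (((n - 1 : ℕ) : ℝ) * ρ ^ (n - 1 - 1))) := by
  obtain ⟨ρ', hρρ', hρ'1⟩ := exists_between hρ
  have hρ'0 : 0 < ρ' := hρ0.trans_lt hρρ'
  set q : ℝ := ρ / ρ' with hq
  have hq0 : 0 ≤ q := div_nonneg hρ0 hρ'0.le
  have hq1 : q < 1 := (div_lt_one hρ'0).2 hρρ'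
  set K : ℝ := (1 - q)⁻¹ / ρ' with hK
  have hK0 : 0 ≤ K := div_nonneg (inv_nonneg.2 (by linarith)) hρ'0.le
  refine Summable.of_nonneg_of_le (fun n ↦ by positivity) (fun n ↦ ?_)
    ((summable_abs_hypHalfGenCoeff_mul_weight α β hρ'0.le hρ'1).mul_left K)
  -- `(n-1) ρⁿ⁻² ≤ K ρ'ⁿ⁻¹`
  have hw : (((n - 1 : ℕ) : ℝ) * ρ ^ (n - 1 - 1)) ≤ K * ρ' ^ (n - 1) := by
    rcases n with _ | _ | m
    · simp; positivity
    · simp; positivity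
    · have h1 := nat_mul_pow_pred_le hq0 hq1 (m + 1)
      simp only [Nat.add_sub_cancel, show m + 2 - 1 = m + 1 from rfl] at h1 ⊢
      have hρeq : ρ = q * ρ' := by rw [hq]; field_simp
      rw [hρeq, mul_pow, ← mul_assoc, hK, pow_succ]
      have hρ'm : 0 < ρ' ^ m := pow_pos hρ'0 m
      calc ((m + 1 : ℕ) : ℝ) * q ^ m * ρ' ^ m ≤ (1 - q)⁻¹ * ρ' ^ m :=
            mul_le_mul_of_nonneg_right h1 hρ'm.le
        _ = (1 - q)⁻¹ / ρ' * (ρ' ^ m * ρ') := by field_simp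
  calc |hypHalfGenCoeff α β n| * ((n : ℝ) * (((n - 1 : ℕ) : ℝ) * ρ ^ (n - 1 - 1)))
      ≤ |hypHalfGenCoeff α β n| * ((n : ℝ) * (K * ρ' ^ (n - 1))) := by
        gcongr
    _ = K * (|hypHalfGenCoeff α β n| * ((n : ℝ) * ρ' ^ (n - 1))) := by ring

variable {α β}

/-- `Σ cₙ rⁿ` converges for `|r| < 1`. [folklore] -/
theorem summable_hypHalfGen_term {r : ℝ} (hr : |r| < 1) :
    Summable fun n ↦ hypHalfGenCoeff α β n * r ^ n := by
  refine Summable.of_norm_bounded (summable_abs_hypHalfGenCoeff_mul_pow α β (abs_nonneg r) hr)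
    fun n ↦ ?_
  rw [Real.norm_eq_abs, abs_mul, abs_pow]

/-- **Term-wise differentiation of `₂F₁(α, β, 1/2, ·)`** on `|r| < 1`. [folklore] -/
theorem hasDerivAt_hypHalfGen {r : ℝ} (hr : |r| < 1) :
    HasDerivAt (fun x ↦ ₂F₁ α β (1 / 2 : ℝ) x) (hypHalfGenDeriv α β r) r := by
  obtain ⟨ρ, hrρ, hρ1⟩ := exists_between hr
  have hρ0 : 0 ≤ ρ := (abs_nonneg r).trans hrρ.le
  have hρpos : 0 < ρ := (abs_nonneg r).trans_lt hrρ
  have hfun : (fun x ↦ ₂F₁ α β (1 / 2 : ℝ) x) = fun x ↦ ∑' n, hypHalfGenCoeff α β n * x ^ n :=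
    funext (hypHalfGen_eq_tsum α β)
  rw [hfun, hypHalfGenDeriv]
  refine hasDerivAt_tsum_of_isPreconnected
    (u := fun n : ℕ ↦ |hypHalfGenCoeff α β n| * ((n : ℝ) * ρ ^ (n - 1)))
    (t := Ioo (-ρ) ρ) (y₀ := 0) (summable_abs_hypHalfGenCoeff_mul_weight α β hρ0 hρ1) isOpen_Ioo
    (convex_Ioo _ _).isPreconnected (fun n y _ ↦ (hasDerivAt_pow n y).const_mul _)
    (fun n y hy ↦ ?_) ⟨by linarith, hρpos⟩ ?_ (abs_lt.1 hrρ)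
  · have hy' : |y| ≤ ρ := (abs_lt.2 hy).le
    rw [Real.norm_eq_abs, abs_mul, abs_mul, abs_pow, Nat.abs_cast]
    gcongr
  · simpa using summable_hypHalfGen_term (α := α) (β := β) (r := 0) (by simp)

/-- **Term-wise differentiation of `F₁ = Σ cₙ n rⁿ⁻¹`** on `|r| < 1`. [folklore] -/
theorem hasDerivAt_hypHalfGenDeriv {r : ℝ} (hr : |r| < 1) :
    HasDerivAt (hypHalfGenDeriv α β) (hypHalfGenDeriv₂ α β r) r := by
  obtain ⟨ρ, hrρ, hρ1⟩ := exists_between hr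
  have hρ0 : 0 ≤ ρ := (abs_nonneg r).trans hrρ.le
  have hρpos : 0 < ρ := (abs_nonneg r).trans_lt hrρ
  unfold hypHalfGenDeriv hypHalfGenDeriv₂
  refine hasDerivAt_tsum_of_isPreconnected
    (u := fun n : ℕ ↦ |hypHalfGenCoeff α β n| * ((n : ℝ) * (((n - 1 : ℕ) : ℝ) * ρ ^ (n - 1 - 1))))
    (t := Ioo (-ρ) ρ) (y₀ := 0) (summable_abs_hypHalfGenCoeff_mul_weight₂ α β hρ0 hρ1) isOpen_Ioo
    (convex_Ioo _ _).isPreconnected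
    (fun n y _ ↦ ((hasDerivAt_pow (n - 1) y).const_mul _).const_mul _)
    (fun n y hy ↦ ?_) ⟨by linarith, hρpos⟩ ?_ (abs_lt.1 hrρ)
  · have hy' : |y| ≤ ρ := (abs_lt.2 hy).le
    rw [Real.norm_eq_abs, abs_mul, abs_mul, abs_mul, abs_pow, Nat.abs_cast, Nat.abs_cast]
    gcongr
  · refine Summable.of_norm_bounded
      (summable_abs_hypHalfGenCoeff_mul_weight α β le_rfl one_pos) fun n ↦ ?_
    rw [Real.norm_eq_abs, abs_mul, abs_mul, Nat.abs_cast, abs_pow, abs_zero]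

/-- `HasSum (cₙ rⁿ) (₂F₁ α β (1/2) r)` for `|r| < 1`. [folklore] -/
theorem hasSum_hypHalfGen {r : ℝ} (hr : |r| < 1) :
    HasSum (fun n ↦ hypHalfGenCoeff α β n * r ^ n) (₂F₁ α β (1 / 2 : ℝ) r) := by
  rw [hypHalfGen_eq_tsum]
  exact (summable_hypHalfGen_term hr).hasSum

/-- `HasSum (cₙ n rⁿ⁻¹) (F₁ r)` for `|r| < 1`. [folklore] -/
theorem hasSum_hypHalfGenDeriv {r : ℝ} (hr : |r| < 1) :
    HasSum (fun n : ℕ ↦ hypHalfGenCoeff α β n * ((n : ℝ) * r ^ (n - 1))) (hypHalfGenDeriv α β r) := by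
  have hs : Summable fun n : ℕ ↦ hypHalfGenCoeff α β n * ((n : ℝ) * r ^ (n - 1)) := by
    refine Summable.of_norm_bounded
      (summable_abs_hypHalfGenCoeff_mul_weight α β (abs_nonneg r) hr) fun n ↦ ?_
    rw [Real.norm_eq_abs, abs_mul, abs_mul, abs_pow, Nat.abs_cast]
  exact hs.hasSum

/-- `HasSum (cₙ n (n-1) rⁿ⁻²) (F₂ r)` for `|r| < 1`. [folklore] -/
theorem hasSum_hypHalfGenDeriv₂ {r : ℝ} (hr : |r| < 1) :
    HasSum (fun n : ℕ ↦ hypHalfGenCoeff α β n * ((n : ℝ) * (((n - 1 : ℕ) : ℝ) * r ^ (n - 1 - 1))))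
      (hypHalfGenDeriv₂ α β r) := by
  have hs : Summable fun n : ℕ ↦
      hypHalfGenCoeff α β n * ((n : ℝ) * (((n - 1 : ℕ) : ℝ) * r ^ (n - 1 - 1))) := by
    refine Summable.of_norm_bounded
      (summable_abs_hypHalfGenCoeff_mul_weight₂ α β (abs_nonneg r) hr) fun n ↦ ?_
    rw [Real.norm_eq_abs, abs_mul, abs_mul, abs_mul, abs_pow, Nat.abs_cast, Nat.abs_cast]
  exact hs.hasSum

/-- **The hypergeometric equation for `₂F₁(α, β, 1/2, ·)`**:
`r(1-r) F'' + (1/2 - (α+β+1) r) F' - αβ F = 0` on `|r| < 1` (term-wise, the coefficient of `rᵐ`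
is `(m+1)(m+1/2) c_{m+1} - (m+α)(m+β) cₘ = 0`, the recursion `hypHalfGenCoeff_succ`; summed by
telescoping). [folklore] -/
theorem hypHalfGen_ode {r : ℝ} (hr : |r| < 1) :
    r * (1 - r) * hypHalfGenDeriv₂ α β r + (1 / 2 - (α + β + 1) * r) * hypHalfGenDeriv α β r -
      α * β * ₂F₁ α β (1 / 2 : ℝ) r = 0 := by
  set c : ℕ → ℝ := hypHalfGenCoeff α β with hc
  have S0 := hasSum_hypHalfGen (α := α) (β := β) hr
  have S1 := hasSum_hypHalfGenDeriv (α := α) (β := β) hr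
  have S2 := hasSum_hypHalfGenDeriv₂ (α := α) (β := β) hr
  set A : ℕ → ℝ := fun n ↦ c n * ((n : ℝ) * (((n - 1 : ℕ) : ℝ) + 1 / 2)) * r ^ (n - 1) with hA
  set B : ℕ → ℝ := fun n ↦ c n * (((n : ℝ) + α) * ((n : ℝ) + β)) * r ^ n with hB
  have hAsum : HasSum A (r * hypHalfGenDeriv₂ α β r + 1 / 2 * hypHalfGenDeriv α β r) := by
    have h := (S2.mul_left r).add (S1.mul_left (1 / 2))
    have hfun : (fun n : ℕ ↦ r * (hypHalfGenCoeff α β n * ((n : ℝ) * (((n - 1 : ℕ) : ℝ) * r ^ (n - 1 - 1)))) +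
        1 / 2 * (hypHalfGenCoeff α β n * ((n : ℝ) * r ^ (n - 1)))) = A := by
      funext n
      simp only [hA, hc]
      rcases n with _ | _ | m
      · simp
      · simp
        ring
      · simp only [Nat.add_sub_cancel, show m + 2 - 1 = m + 1 from rfl]
        push_cast
        ring
    rwa [hfun] at h
  have hA0 : A 0 = 0 := by simp [hA]
  have hBA : ∀ n, B n = A (n + 1) := by
    intro n
    simp only [hA, hB, Nat.add_sub_cancel, hc, hypHalfGenCoeff_succ]
    have h1 : (1 / 2 + (n : ℝ)) ≠ 0 := by positivity
    have h2 : ((n : ℝ) + 1) ≠ 0 := by positivity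
    push_cast
    field_simp
    ring
  have hBsum : HasSum B (r * hypHalfGenDeriv₂ α β r + 1 / 2 * hypHalfGenDeriv α β r) := by
    have h := (hasSum_nat_add_iff' 1).2 hAsum
    rw [Finset.sum_range_one, hA0, sub_zero] at h
    have hfun : (fun n ↦ A (n + 1)) = B := funext fun n ↦ (hBA n).symm
    rwa [hfun] at h
  have hT : HasSum (fun n ↦ A n - B n)
      (r * (1 - r) * hypHalfGenDeriv₂ α β r + (1 / 2 - (α + β + 1) * r) * hypHalfGenDeriv α β r -
        α * β * ₂F₁ α β (1 / 2 : ℝ) r) := by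
    have h := ((S2.mul_left (r * (1 - r))).add (S1.mul_left (1 / 2 - (α + β + 1) * r))).sub
      (S0.mul_left (α * β))
    have hfun : (fun n : ℕ ↦
        r * (1 - r) * (hypHalfGenCoeff α β n * ((n : ℝ) * (((n - 1 : ℕ) : ℝ) * r ^ (n - 1 - 1)))) +
          (1 / 2 - (α + β + 1) * r) * (hypHalfGenCoeff α β n * ((n : ℝ) * r ^ (n - 1))) -
          α * β * (hypHalfGenCoeff α β n * r ^ n)) = fun n ↦ A n - B n := by
      funext n
      simp only [hA, hB, hc]
      rcases n with _ | _ | m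
      · simp
        ring
      · simp
        ring
      · simp only [Nat.add_sub_cancel, show m + 2 - 1 = m + 1 from rfl]
        push_cast
        ring
    rwa [hfun] at h
  have h0 : HasSum (fun n ↦ A n - B n) 0 := by
    simpa using hAsum.sub hBsum
  exact hT.unique h0

/-- `₂F₁(α, β, 1/2, ·)` is `Cⁿ` (indeed analytic) at every `|x| < 1`. [folklore] -/
theorem contDiffAt_hypHalfGen {x : ℝ} (hx : |x| < 1) {n : WithTop ℕ∞} :
    ContDiffAt ℝ n (fun y ↦ ₂F₁ α β (1 / 2 : ℝ) y) x := by
  set p := ordinaryHypergeometricSeries ℝ α β (1 / 2 : ℝ) with hp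
  have hrad : 0 < p.radius := lt_of_lt_of_le zero_lt_one (one_le_radius_hypHalfGen α β)
  have hps : HasFPowerSeriesOnBall (fun y ↦ ₂F₁ α β (1 / 2 : ℝ) y) p 0 p.radius :=
    p.hasFPowerSeriesOnBall hrad
  have hxmem : x ∈ Metric.eball (0 : ℝ) p.radius := by
    refine Metric.eball_subset_eball (one_le_radius_hypHalfGen α β) ?_
    rw [← ENNReal.ofReal_one, Metric.eball_ofReal, mem_ball_zero_iff, Real.norm_eq_abs]
    exact hx
  exact (hps.analyticAt_of_mem hxmem).contDiffAt

end HypHalfGen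

/-! ### Rohde–Schramm's `Ĝ_{a,κ}` along the slope, for a general exponent `a` -/

section RS

variable {a κ : ℝ}

/-- **`η₀ + η₁ = 1 - 4/κ`**. [cite: RohdeSchramm2005, Lemma 6.3] -/
theorem rsEta₀_add_rsEta₁ (a κ : ℝ) : rsEta₀ a κ + rsEta₁ a κ = 1 - 4 / κ := by
  rw [rsEta₀, rsEta₁]; ring

/-- **`η₀ η₁ = -2a/κ`** when the discriminant `32aκ + (2κ-8)²` is non-negative (`κ ≠ 0`).
[cite: RohdeSchramm2005, Lemma 6.3] -/
theorem rsEta₀_mul_rsEta₁ (hκ : κ ≠ 0) (hdisc : 0 ≤ 32 * a * κ + (2 * κ - 8) ^ 2) :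
    rsEta₀ a κ * rsEta₁ a κ = -2 * a / κ := by
  rw [rsEta₀, rsEta₁]
  have hsq := Real.sq_sqrt hdisc
  set s := Real.sqrt (32 * a * κ + (2 * κ - 8) ^ 2) with hs
  have h1 : (1 / 2 - 2 / κ - s / (4 * κ)) * (1 / 2 - 2 / κ + s / (4 * κ)) =
      (1 / 2 - 2 / κ) ^ 2 - s ^ 2 / (16 * κ ^ 2) := by ring
  rw [h1, hsq]
  field_simp
  ring

/-- **`Ĝ_{a,κ}` along the slope**: `rsGhatSlope a κ w := ₂F₁(η₀, η₁, 1/2, w²/(1+w²)) = Ĝ_{a,κ}(w + i)`.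
[cite: RohdeSchramm2005, Lemma 6.3] -/
def rsGhatSlope (a κ w : ℝ) : ℝ :=
  ₂F₁ (rsEta₀ a κ) (rsEta₁ a κ) (1 / 2 : ℝ) (slopeArg w)

/-- `Ĝ_{a,κ}(z) = rsGhatSlope a κ (Re z / Im z)` for `Im z ≠ 0`. [cite: RohdeSchramm2005, Lemma 6.3] -/
theorem rsGhat_eq_rsGhatSlope (a κ : ℝ) {Z : ℂ} (hZ : Z.im ≠ 0) :
    rsGhat a κ Z = rsGhatSlope a κ (Z.re / Z.im) := by
  rw [rsGhat, re_sq_div_eq hZ, rsGhatSlope, slopeArg]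

/-- At the diagonal exponent `a(κ)`, `rsGhatSlope` is the `rsGhatW` of layer 4b. [folklore] -/
theorem rsGhatSlope_rsExponent (hκ : κ ≠ 0) (w : ℝ) :
    rsGhatSlope (rsExponent κ) κ w = rsGhatW κ w := by
  rw [rsGhatSlope, rsEta₀_rsExponent hκ, rsEta₁_rsExponent hκ, rsGhatW, slopeArg]

/-- `rsGhatSlope a κ = ₂F₁(η₀, η₁, 1/2, ·) ∘ slopeArg`. [folklore] -/
theorem rsGhatSlope_eq_comp (a κ : ℝ) :
    rsGhatSlope a κ = (fun x ↦ ₂F₁ (rsEta₀ a κ) (rsEta₁ a κ) (1 / 2 : ℝ) x) ∘ slopeArg := by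
  funext w
  rfl

/-- `h'(w) = F₁(r(w)) r'(w)` for `h = rsGhatSlope a κ`. [folklore] -/
theorem hasDerivAt_rsGhatSlope (a κ w : ℝ) :
    HasDerivAt (rsGhatSlope a κ)
      (hypHalfGenDeriv (rsEta₀ a κ) (rsEta₁ a κ) (slopeArg w) * (2 * w / (1 + w ^ 2) ^ 2)) w := by
  rw [rsGhatSlope_eq_comp]
  exact (hasDerivAt_hypHalfGen (abs_slopeArg_lt_one w)).comp w (hasDerivAt_slopeArg w)

/-- `deriv (rsGhatSlope a κ) = fun w ↦ F₁(r w) r'(w)`. [folklore] -/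
theorem deriv_rsGhatSlope (a κ : ℝ) :
    deriv (rsGhatSlope a κ) =
      fun w ↦ hypHalfGenDeriv (rsEta₀ a κ) (rsEta₁ a κ) (slopeArg w) * (2 * w / (1 + w ^ 2) ^ 2) :=
  funext fun w ↦ (hasDerivAt_rsGhatSlope a κ w).deriv

/-- `h''(w) = F₂(r) r'² + F₁(r) r''` for `h = rsGhatSlope a κ`. [folklore] -/
theorem hasDerivAt_deriv_rsGhatSlope (a κ w : ℝ) :
    HasDerivAt (deriv (rsGhatSlope a κ))
      (hypHalfGenDeriv₂ (rsEta₀ a κ) (rsEta₁ a κ) (slopeArg w) * (2 * w / (1 + w ^ 2) ^ 2) *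
          (2 * w / (1 + w ^ 2) ^ 2) +
        hypHalfGenDeriv (rsEta₀ a κ) (rsEta₁ a κ) (slopeArg w) * ((2 - 6 * w ^ 2) / (1 + w ^ 2) ^ 3)) w := by
  rw [deriv_rsGhatSlope]
  have h1 : HasDerivAt (fun w ↦ hypHalfGenDeriv (rsEta₀ a κ) (rsEta₁ a κ) (slopeArg w))
      (hypHalfGenDeriv₂ (rsEta₀ a κ) (rsEta₁ a κ) (slopeArg w) * (2 * w / (1 + w ^ 2) ^ 2)) w :=
    (hasDerivAt_hypHalfGenDeriv (abs_slopeArg_lt_one w)).comp w (hasDerivAt_slopeArg w)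
  exact h1.mul (hasDerivAt_deriv_slopeArg w)

/-- `deriv (deriv (rsGhatSlope a κ)) w = F₂(r) r'² + F₁(r) r''`. [folklore] -/
theorem deriv_deriv_rsGhatSlope (a κ w : ℝ) :
    deriv (deriv (rsGhatSlope a κ)) w =
      hypHalfGenDeriv₂ (rsEta₀ a κ) (rsEta₁ a κ) (slopeArg w) * (2 * w / (1 + w ^ 2) ^ 2) *
          (2 * w / (1 + w ^ 2) ^ 2) +
        hypHalfGenDeriv (rsEta₀ a κ) (rsEta₁ a κ) (slopeArg w) * ((2 - 6 * w ^ 2) / (1 + w ^ 2) ^ 3) :=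
  (hasDerivAt_deriv_rsGhatSlope a κ w).deriv

/-- **Rohde–Schramm's equation (6.9) for `Ĝ_{a,κ}` at `y = 1`, general exponent**: for `κ > 0`
and `32aκ + (2κ-8)² ≥ 0`, with `h = rsGhatSlope a κ` (`= Ĝ_{a,κ}(w + i)`),
`(κ/2) h''(w) + (4w/(1+w²)) h'(w) + (4a/(1+w²)²) h(w) = 0` for every real `w`
("Since `Ĝ` satisfies `(4a y²/|z|⁴) Ĝ + (κ/2) ∂ₓ²Ĝ + (4x/|z|²) ∂ₓĜ = 0` for `y = 1`", p. 906).
From the hypergeometric equation `hypHalfGen_ode` through `r = w²/(1+w²)` and the identities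
`η₀ + η₁ = 1 - 4/κ`, `η₀ η₁ = -2a/κ`. [cite: RohdeSchramm2005, Lemma 6.3] -/
theorem rsGhatSlope_ode (hκ : 0 < κ) (hdisc : 0 ≤ 32 * a * κ + (2 * κ - 8) ^ 2) (w : ℝ) :
    κ / 2 * deriv (deriv (rsGhatSlope a κ)) w + 4 * w / (1 + w ^ 2) * deriv (rsGhatSlope a κ) w +
      4 * a / (1 + w ^ 2) ^ 2 * rsGhatSlope a κ w = 0 := by
  have hκ0 : κ ≠ 0 := hκ.ne'
  have hode := hypHalfGen_ode (α := rsEta₀ a κ) (β := rsEta₁ a κ) (abs_slopeArg_lt_one w)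
  have hsum := rsEta₀_add_rsEta₁ a κ
  have hprod := rsEta₀_mul_rsEta₁ hκ0 hdisc
  rw [deriv_deriv_rsGhatSlope, deriv_rsGhatSlope]
  beta_reduce
  have hG : rsGhatSlope a κ w = ₂F₁ (rsEta₀ a κ) (rsEta₁ a κ) (1 / 2 : ℝ) (slopeArg w) := rfl
  rw [hG]
  set X := hypHalfGenDeriv₂ (rsEta₀ a κ) (rsEta₁ a κ) (slopeArg w)
  set Y := hypHalfGenDeriv (rsEta₀ a κ) (rsEta₁ a κ) (slopeArg w)
  set Z := ₂F₁ (rsEta₀ a κ) (rsEta₁ a κ) (1 / 2 : ℝ) (slopeArg w)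
  set S := rsEta₀ a κ + rsEta₁ a κ with hS
  set Pr := rsEta₀ a κ * rsEta₁ a κ with hPr
  have hode' : slopeArg w * (1 - slopeArg w) * X + (1 / 2 - (S + 1) * slopeArg w) * Y - Pr * Z = 0 := by
    rw [hS, hPr]; exact hode
  rw [hsum] at hode'
  rw [hprod] at hode'
  simp only [slopeArg] at hode' ⊢
  have hP : (1 + w ^ 2) ≠ 0 := by positivity
  field_simp at hode'
  field_simp
  linear_combination 2 * hode'

/-- `rsGhatSlope a κ` is `Cⁿ` for every `n`. [folklore] -/
theorem contDiff_rsGhatSlope (a κ : ℝ) {n : WithTop ℕ∞} : ContDiff ℝ n (rsGhatSlope a κ) := by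
  rw [rsGhatSlope_eq_comp, contDiff_iff_contDiffAt]
  intro w
  exact (contDiffAt_hypHalfGen (abs_slopeArg_lt_one w)).comp w contDiff_slopeArg.contDiffAt

/-- `iteratedDeriv 2 (rsGhatSlope a κ) = deriv (deriv (rsGhatSlope a κ))`. [folklore] -/
theorem iteratedDeriv_two_rsGhatSlope (a κ : ℝ) :
    iteratedDeriv 2 (rsGhatSlope a κ) = deriv (deriv (rsGhatSlope a κ)) := by
  rw [iteratedDeriv_succ, iteratedDeriv_one]

/-- **(6.9) with `iteratedDeriv`**, general exponent. [cite: RohdeSchramm2005, Lemma 6.3] -/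
theorem rsGhatSlope_ode' (hκ : 0 < κ) (hdisc : 0 ≤ 32 * a * κ + (2 * κ - 8) ^ 2) (w : ℝ) :
    κ / 2 * iteratedDeriv 2 (rsGhatSlope a κ) w + 4 * w / (1 + w ^ 2) * deriv (rsGhatSlope a κ) w +
      4 * a / (1 + w ^ 2) ^ 2 * rsGhatSlope a κ w = 0 := by
  rw [iteratedDeriv_two_rsGhatSlope]
  exact rsGhatSlope_ode hκ hdisc w

end RS

end Literature.Probability.RandomPlanarGeometry

end
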